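import Literature.Geometry.Kaehler.ComplexTorusHodgeLieAlgebraRatProductHomomorphisms
import HarnessLib

/-!
# `Hom_ℚ(X₁, X₂)` IS the space of `𝒜(X₁ × X₂)`-intertwiners `V₁ → V₂` (Lange 7.2.5 ∕ Exercise 7.2.4 (3) for a product, over `ℚ`);
# the kernels `K₁`, `K₂` of `Hg(X₁ × X₂) → Hg(Xᵢ)` are FINITE iff the rational Goursat ideals vanish iff the other block
# projection is a `ℚ`-isomorphism `𝒜(X₁ × X₂) ≅ 𝒜(X_j)`; transfer of abelian ∕ solvable ∕ semisimple ∕ reductive along a finite kernel, over `ℚ`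

Layer `Literature/Geometry/Kaehler`, namespace `Literature.Geometry.Kaehler.ComplexTorus`; lane `lit-hodgefound` (Track 2
foundations library), Layer A3/A4; prover seat `lit-hodgefound-p17` (generation 42, self-proposed row g42-#5), sequel of g42-#4
`ComplexTorusHodgeLieAlgebraRatProductHomomorphisms` (`P C₁₁ = C₂₂ P`: homomorphisms intertwine) and of g42-#1
`ComplexTorusHodgeLieAlgebraRatProductGoursat` (`exists_lieHom_toBlocks_rat`, `exists_lieIdeal_rat_lieEquiv_quotient`: `dim_ℚ Nᵢ = dim Kᵢ°`,
`dim_ℚ 𝒜(X) = dim_ℚ 𝒜(X₁) + dim_ℚ N₂`), with p36's «`C_{M(ℚ)}(𝒜) = End⁰`» (`mem_endAlgRat_iff_forall_hodgeGroupLieRat_comm`, Lange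
7.2.4 Exercise (3) over `ℚ`), the block form of `End_ℚ(X₁ × X₂)` (`fromBlocks_mem_endAlgRat_prod_iff`), p38's `K₂` finite ⟺
`dim Hg(X₁ × X₂) = dim Hg(X₁)` (`finite_hodgeGroupCProdInr_iff_zdim_prod_eq`) and the pure Lie lemmas of `ReductiveIdealsQuotients`
(surjective images of abelian ∕ solvable ∕ semisimple ∕ reductive algebras).  The `ℂ`-twins are g41-#5 §4
(`finite_hodgeGroupCProdInr_iff_nonempty_lieEquiv`) and g41-#11 (`ComplexTorusHodgeGroupProductFiniteKernelTransfer`).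
THEOREMS ONLY (no definition, no instance, no notation, no named fact; D-0026 net debt 0).

## Sources, verbatim

* [Lange2023AbelianVarietiesComplex] H. Lange, *Abelian Varieties over the Complex Numbers* (2023), §7.2.2 Prop. 7.2.5 («`End_ℚ(X) ≃
  End(V)^{Hg(X)}`») and §7.2.4 Exercise (3) («`End_ℚ(X) = End_{Hg(X)}(H_1(X, ℚ))`»), applied to `X = X₁ × X₂` with the block form
  of §2.4.4 Cor. 2.4.26 (proof): `Hom_ℚ(X₁, X₂)` is the `(2,1)`-corner of `End_ℚ(X₁ × X₂)`.
* [MoonenZarhin1999LowDim] B. Moonen, Yu. G. Zarhin, Math. Ann. 315 (1999), §3 (3.1) and Lemma (3.6), proof (p0007 L22–L28: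
  «`𝔥𝔤(X) = 𝔤₁ ⊕ 𝔤₃ ≅ 𝔥𝔤(X₁)` and `𝔥𝔤(X₂) ≅ 𝔤₃`» — the case `𝔤₂ = 0`, i.e. `K₂` finite).
* [Gordon1997] B. B. Gordon, §2.16 Proposition (Goursat) and §2.12.
* [Imai1976HodgeGroups] H. Imai, Kōdai Math. Sem. Rep. 27 (1976), §3 Remarks.
* [Bourbaki1989LieGroups13] N. Bourbaki, *Lie Groups and Lie Algebras, Chapters 1–3*, Ch. I §6 no. 2 Lemma 1, no. 4 Cor. (c).
* [Springer1998] T. A. Springer, *Linear Algebraic Groups*, 2nd ed., 2.2.1, 1.8.2, 4.4.5–4.4.7.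

## What is proved (arbitrary complex tori)

* §1 `Hom_ℚ` AS INTERTWINERS: **`mem_homRat_iff_forall_mul_toBlocks₁₁_eq_toBlocks₂₂_mul`** (`F ∈ Hom_ℚ(X₁, X₂) ⟺ F C₁₁ = C₂₂ F`
  for all `C ∈ 𝒜(X₁ × X₂)`), `mem_homRat_iff_forall_mul_toBlocks₂₂_eq_toBlocks₁₁_mul` (`Hom_ℚ(X₂, X₁)`),
  `homRat_eq_bot_iff_forall_hodgeGroupLieRat_prod` (`Hom_ℚ(X₁, X₂) = 0 ⟺` only the zero intertwiner).
* §2 FINITE KERNELS OVER `ℚ`: **`finite_hodgeGroupCProdInr_iff_forall_zero_fromBlocks_mem_imp`** (`K₂` finite ⟺ `𝔤₂(ℚ) = 0`: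
  `(0 0; 0 W) ∈ 𝒜(X₁ × X₂) ⟹ W = 0`), **`finite_hodgeGroupCProdInr_iff_nonempty_lieEquiv_hodgeGroupLieRat`** (⟺ `r₁ : 𝒜(X₁ × X₂) ≅ 𝒜(X₁)`
  over `ℚ`), `finite_hodgeGroupCProdInr_iff_finrank_hodgeGroupLieRat_prod_eq`, and the mirrors for `K₁`
  (`finite_hodgeGroupCProdInl_iff_forall_fromBlocks_zero_mem_imp`, `finite_hodgeGroupCProdInl_iff_nonempty_lieEquiv_hodgeGroupLieRat`,
  `finite_hodgeGroupCProdInl_iff_finrank_hodgeGroupLieRat_prod_eq`); `finite_hodgeGroupCProdInr_of_mem_homRat_of_right_inverse`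
  (a quotient factor has finite `K₂`), `finite_hodgeGroupCProdInl_of_mem_homRat_of_left_inverse`, `IsIsogenous.finite_hodgeGroupCProdInl_and_Inr`.
* §3 TRANSFER ALONG A FINITE KERNEL OVER `ℚ`: **`exists_surjective_lieHom_hodgeGroupLieRat_of_finite_hodgeGroupCProdInl`** (`K₁` finite ⟹
  `𝒜(X₂) ↠ 𝒜(X₁)` over `ℚ`, `r₁ ∘ r₂⁻¹`) and mirror, `isLieAbelian_hodgeGroupLieRat_of_finite_hodgeGroupCProdInl`,
  `isSolvable_…`, `isSemisimple_…`, `hasCentralRadical_…` (abelian ∕ solvable ∕ semisimple ∕ reductive pass from `𝒜(X₂)` to `𝒜(X₁)`),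
  and the four `…_of_finite_hodgeGroupCProdInr` mirrors.
* §4 DIMENSIONS AND A HODGE-SIMPLE FACTOR: `finrank_hodgeGroupLieRat_left_le_prod` ∕ `_right_le_prod` (`dim_ℚ 𝒜(Xᵢ) ≤ dim_ℚ 𝒜(X₁ × X₂)`),
  `finrank_hodgeGroupLieRat_le_of_finite_hodgeGroupCProdInl` (`K₁` finite ⟹ `dim_ℚ 𝒜(X₁) ≤ dim_ℚ 𝒜(X₂)`) and mirror,
  `finite_hodgeGroupCProdInr_of_finite_hodgeGroupCProdInl_of_finrank_le` (+ mirror, + `…_iff_…_of_finrank_eq`),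
  **`nonempty_hodgeGroupLieRat_lieEquiv_of_isSimple_right_of_finite_hodgeGroupCProdInl`** (`𝒜(X₂)` simple, `K₁` finite, `dim X₁ > 0` ⟹
  `𝒜(X₁) ≅ 𝒜(X₂)` over `ℚ`) and `finite_hodgeGroupCProdInr_of_isSimple_right_of_finite_hodgeGroupCProdInl` (⟹ `K₂` finite too), with mirrors.
-/

noncomputable section

open Matrix Module Function

namespace Literature.Geometry.Kaehler

namespace ComplexTorus

open Literature.NumberTheory.Automorphic (IsAlgebraicSubgroup IsZConnected identityComponent isZConnected_identityComponent
  lieAlgebraGL lieSubalgebraGL)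
open Literature.Algebra.Lie

variable {ι₁ ι₂ : Type*} [Fintype ι₁] [Fintype ι₂] [DecidableEq ι₁] [DecidableEq ι₂]
  {E₁ E₂ : Type*} [NormedAddCommGroup E₁] [NormedSpace ℂ E₁] [NormedAddCommGroup E₂] [NormedSpace ℂ E₂]
  (Φ₁ : (ι₁ → ℝ) ≃L[ℝ] E₁) (Φ₂ : (ι₂ → ℝ) ≃L[ℝ] E₂)

/-! ### §1 `Hom_ℚ(X₁, X₂) = {F : V₁ → V₂ | F C₁₁ = C₂₂ F for all C ∈ 𝒜(X₁ × X₂)}` -/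

/-- **`Hom_ℚ(X₁, X₂)` IS THE SPACE OF `𝒜(X₁ × X₂)`-INTERTWINERS**: `F ∈ Hom_ℚ(X₁, X₂) ⟺ F C₁₁ = C₂₂ F` for every `C ∈ 𝒜(X₁ × X₂)`
(⟸: the corner `(0 0; F 0)` commutes with `𝒜(X₁ × X₂)`, hence lies in `End_ℚ(X₁ × X₂) = C_{M(ℚ)}(𝒜(X₁ × X₂))`, whose `(2,1)` block is
`Hom_ℚ(X₁, X₂)`). [cite: Lange2023AbelianVarietiesComplex, §7.2.4 Exercise (3) and §7.2.2 Prop. 7.2.5, §2.4.4 Cor. 2.4.26 (proof)] -/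
theorem mem_homRat_iff_forall_mul_toBlocks₁₁_eq_toBlocks₂₂_mul {F : Matrix ι₂ ι₁ ℚ} :
    F ∈ homRat Φ₁ Φ₂ ↔ ∀ C ∈ hodgeGroupLieRat (prodPeriod Φ₁ Φ₂), F * C.toBlocks₁₁ = C.toBlocks₂₂ * F := by
  refine ⟨fun hF C hC ↦ mul_toBlocks₁₁_eq_toBlocks₂₂_mul_of_mem_homRat Φ₁ Φ₂ hC hF, fun h ↦ ?_⟩
  have hmem : fromBlocks (0 : Matrix ι₁ ι₁ ℚ) 0 F (0 : Matrix ι₂ ι₂ ℚ) ∈ endAlgRat (prodPeriod Φ₁ Φ₂) := by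
    refine (mem_endAlgRat_iff_forall_hodgeGroupLieRat_comm (prodPeriod Φ₁ Φ₂)).2 fun C hC ↦ ?_
    rw [eq_fromBlocks_of_mem_hodgeGroupLieRat_prod Φ₁ Φ₂ hC, fromBlocks_multiply, fromBlocks_multiply]
    simp only [Matrix.mul_zero, Matrix.zero_mul, add_zero, zero_add, h C hC]
  exact ((fromBlocks_mem_endAlgRat_prod_iff Φ₁ Φ₂).1 hmem).2.2.1

/-- **`Hom_ℚ(X₂, X₁)` as intertwiners**: `F ∈ Hom_ℚ(X₂, X₁) ⟺ F C₂₂ = C₁₁ F` for every `C ∈ 𝒜(X₁ × X₂)`.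
[cite: Lange2023AbelianVarietiesComplex, §7.2.4 Exercise (3) and §2.4.4 Cor. 2.4.26 (proof)] -/
theorem mem_homRat_iff_forall_mul_toBlocks₂₂_eq_toBlocks₁₁_mul {F : Matrix ι₁ ι₂ ℚ} :
    F ∈ homRat Φ₂ Φ₁ ↔ ∀ C ∈ hodgeGroupLieRat (prodPeriod Φ₁ Φ₂), F * C.toBlocks₂₂ = C.toBlocks₁₁ * F := by
  refine ⟨fun hF C hC ↦ mul_toBlocks₂₂_eq_toBlocks₁₁_mul_of_mem_homRat Φ₁ Φ₂ hC hF, fun h ↦ ?_⟩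
  have hmem : fromBlocks (0 : Matrix ι₁ ι₁ ℚ) F 0 (0 : Matrix ι₂ ι₂ ℚ) ∈ endAlgRat (prodPeriod Φ₁ Φ₂) := by
    refine (mem_endAlgRat_iff_forall_hodgeGroupLieRat_comm (prodPeriod Φ₁ Φ₂)).2 fun C hC ↦ ?_
    rw [eq_fromBlocks_of_mem_hodgeGroupLieRat_prod Φ₁ Φ₂ hC, fromBlocks_multiply, fromBlocks_multiply]
    simp only [Matrix.mul_zero, Matrix.zero_mul, add_zero, zero_add, h C hC]
  exact ((fromBlocks_mem_endAlgRat_prod_iff Φ₁ Φ₂).1 hmem).2.1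

/-- The set form: `Hom_ℚ(X₁, X₂) = {F | ∀ C ∈ 𝒜(X₁ × X₂), F C₁₁ = C₂₂ F}`. [cite: Lange2023AbelianVarietiesComplex, §7.2.4 Exercise (3)] -/
theorem coe_homRat_eq_setOf_forall_hodgeGroupLieRat_prod :
    (homRat Φ₁ Φ₂ : Set (Matrix ι₂ ι₁ ℚ)) =
      {F | ∀ C ∈ hodgeGroupLieRat (prodPeriod Φ₁ Φ₂), F * C.toBlocks₁₁ = C.toBlocks₂₂ * F} :=
  Set.ext fun _ ↦ mem_homRat_iff_forall_mul_toBlocks₁₁_eq_toBlocks₂₂_mul Φ₁ Φ₂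

/-- `Hom_ℚ(X₁, X₂) = 0 ⟺` the only intertwiner is `0`. [cite: Lange2023AbelianVarietiesComplex, §7.2.4 Exercise (3)] -/
theorem homRat_eq_bot_iff_forall_hodgeGroupLieRat_prod :
    homRat Φ₁ Φ₂ = ⊥ ↔ ∀ F : Matrix ι₂ ι₁ ℚ,
      (∀ C ∈ hodgeGroupLieRat (prodPeriod Φ₁ Φ₂), F * C.toBlocks₁₁ = C.toBlocks₂₂ * F) → F = 0 := by
  rw [Submodule.eq_bot_iff]
  exact forall_congr' fun F ↦ by rw [mem_homRat_iff_forall_mul_toBlocks₁₁_eq_toBlocks₂₂_mul]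

/-! ### §2 Finite kernels over `ℚ`: `K₂` finite ⟺ `𝔤₂(ℚ) = 0` ⟺ `r₁ : 𝒜(X₁ × X₂) ≅ 𝒜(X₁)` -/

/-- **`K₂` FINITE ⟺ `dim_ℚ 𝒜(X₁ × X₂) = dim_ℚ 𝒜(X₁)`.** [cite: MoonenZarhin1999LowDim, §3 (3.1)] [cite: Springer1998, 2.2.1, 1.8.2 and 4.4.5–4.4.7] -/
theorem finite_hodgeGroupCProdInr_iff_finrank_hodgeGroupLieRat_prod_eq :
    ((hodgeGroupCProdInr Φ₁ Φ₂ : Subgroup (SpecialLinearGroup ι₂ ℂ)) : Set (SpecialLinearGroup ι₂ ℂ)).Finite ↔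
      finrank ℚ (hodgeGroupLieRat (prodPeriod Φ₁ Φ₂)) = finrank ℚ (hodgeGroupLieRat Φ₁) := by
  rw [finite_hodgeGroupCProdInr_iff_zdim_prod_eq, finrank_hodgeGroupLieRat_eq_zdim, finrank_hodgeGroupLieRat_eq_zdim]

/-- **`K₁` FINITE ⟺ `dim_ℚ 𝒜(X₁ × X₂) = dim_ℚ 𝒜(X₂)`.** [cite: MoonenZarhin1999LowDim, §3 (3.1)] [cite: Springer1998, 2.2.1, 1.8.2 and 4.4.5–4.4.7] -/
theorem finite_hodgeGroupCProdInl_iff_finrank_hodgeGroupLieRat_prod_eq :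
    ((hodgeGroupCProdInl Φ₁ Φ₂ : Subgroup (SpecialLinearGroup ι₁ ℂ)) : Set (SpecialLinearGroup ι₁ ℂ)).Finite ↔
      finrank ℚ (hodgeGroupLieRat (prodPeriod Φ₁ Φ₂)) = finrank ℚ (hodgeGroupLieRat Φ₂) := by
  rw [finite_hodgeGroupCProdInl_iff_zdim_prod_eq, finrank_hodgeGroupLieRat_eq_zdim, finrank_hodgeGroupLieRat_eq_zdim]

/-- **`K₂` FINITE ⟺ `𝔤₂(ℚ) = 0`**: `(0 0; 0 W) ∈ 𝒜(X₁ × X₂)` only for `W = 0` (`dim_ℚ 𝔤₂(ℚ) = dim K₂°`, g42-#1).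
[cite: MoonenZarhin1999LowDim, §3 (3.1) and Lemma (3.6), proof ("`𝔥𝔤(X) = 𝔤₁ ⊕ 𝔤₃`")] [cite: Springer1998, 2.2.1 and 1.8.2] -/
theorem finite_hodgeGroupCProdInr_iff_forall_zero_fromBlocks_mem_imp :
    ((hodgeGroupCProdInr Φ₁ Φ₂ : Subgroup (SpecialLinearGroup ι₂ ℂ)) : Set (SpecialLinearGroup ι₂ ℂ)).Finite ↔
      ∀ W : Matrix ι₂ ι₂ ℚ, fromBlocks (0 : Matrix ι₁ ι₁ ℚ) 0 0 W ∈ hodgeGroupLieRat (prodPeriod Φ₁ Φ₂) → W = 0 := by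
  obtain ⟨N₁, N₂, -, hN₂, -, -, -, -, -, hdim, -⟩ := exists_lieIdeal_rat_lieEquiv_quotient Φ₁ Φ₂
  haveI := finite_hodgeGroupLieRat Φ₂
  rw [finite_hodgeGroupCProdInr_iff_finrank_hodgeGroupLieRat_prod_eq, hdim]
  constructor
  · intro h W hW
    have h0 : finrank ℚ N₂ = 0 := by omega
    have hW₂ : W ∈ hodgeGroupLieRat Φ₂ := by
      have h' := toBlocks₂₂_mem_hodgeGroupLieRat Φ₁ Φ₂ hW
      rwa [toBlocks_fromBlocks₂₂] at h'
    have hbot : N₂ = ⊥ := by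
      rw [← LieSubmodule.toSubmodule_eq_bot]
      exact Submodule.finrank_eq_zero.1 h0
    have hmem : (⟨W, hW₂⟩ : hodgeGroupLieRat Φ₂) ∈ N₂ := (hN₂ ⟨W, hW₂⟩).2 hW
    rw [hbot, LieSubmodule.mem_bot] at hmem
    exact congrArg Subtype.val hmem
  · intro h
    have hbot : N₂ = ⊥ := by
      rw [eq_bot_iff]
      intro B hB
      rw [LieSubmodule.mem_bot]
      exact Subtype.ext (h B.1 ((hN₂ B).1 hB))
    rw [hbot]
    change finrank ℚ (hodgeGroupLieRat Φ₁) + finrank ℚ (⊥ : LieIdeal ℚ (hodgeGroupLieRat Φ₂)).toSubmodule = _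
    rw [LieSubmodule.bot_toSubmodule, finrank_bot, add_zero]

/-- **`K₁` FINITE ⟺ `𝔤₁(ℚ) = 0`**: `(W 0; 0 0) ∈ 𝒜(X₁ × X₂)` only for `W = 0`. [cite: MoonenZarhin1999LowDim, §3 (3.1) and Lemma (3.6), proof]
[cite: Springer1998, 2.2.1 and 1.8.2] -/
theorem finite_hodgeGroupCProdInl_iff_forall_fromBlocks_zero_mem_imp :
    ((hodgeGroupCProdInl Φ₁ Φ₂ : Subgroup (SpecialLinearGroup ι₁ ℂ)) : Set (SpecialLinearGroup ι₁ ℂ)).Finite ↔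
      ∀ W : Matrix ι₁ ι₁ ℚ, fromBlocks W 0 0 (0 : Matrix ι₂ ι₂ ℚ) ∈ hodgeGroupLieRat (prodPeriod Φ₁ Φ₂) → W = 0 := by
  obtain ⟨N₁, N₂, hN₁, -, -, -, -, -, -, -, hdim⟩ := exists_lieIdeal_rat_lieEquiv_quotient Φ₁ Φ₂
  haveI := finite_hodgeGroupLieRat Φ₁
  rw [finite_hodgeGroupCProdInl_iff_finrank_hodgeGroupLieRat_prod_eq, hdim]
  constructor
  · intro h W hW
    have h0 : finrank ℚ N₁ = 0 := by omega
    have hW₁ : W ∈ hodgeGroupLieRat Φ₁ := by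
      have h' := toBlocks₁₁_mem_hodgeGroupLieRat Φ₁ Φ₂ hW
      rwa [toBlocks_fromBlocks₁₁] at h'
    have hbot : N₁ = ⊥ := by
      rw [← LieSubmodule.toSubmodule_eq_bot]
      exact Submodule.finrank_eq_zero.1 h0
    have hmem : (⟨W, hW₁⟩ : hodgeGroupLieRat Φ₁) ∈ N₁ := (hN₁ ⟨W, hW₁⟩).2 hW
    rw [hbot, LieSubmodule.mem_bot] at hmem
    exact congrArg Subtype.val hmem
  · intro h
    have hbot : N₁ = ⊥ := by
      rw [eq_bot_iff]
      intro A hA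
      rw [LieSubmodule.mem_bot]
      exact Subtype.ext (h A.1 ((hN₁ A).1 hA))
    rw [hbot]
    change finrank ℚ (hodgeGroupLieRat Φ₂) + finrank ℚ (⊥ : LieIdeal ℚ (hodgeGroupLieRat Φ₁)).toSubmodule = _
    rw [LieSubmodule.bot_toSubmodule, finrank_bot, add_zero]

/-- **`K₂` FINITE ⟺ `r₁ : 𝒜(X₁ × X₂) ≅ 𝒜(X₁)` OVER `ℚ`** («`𝔥𝔤(X) = 𝔤₁ ⊕ 𝔤₃ ≅ 𝔥𝔤(X₁)`»: `r₁` is onto, and injective exactly when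
`𝔤₂(ℚ) = 0`). [cite: MoonenZarhin1999LowDim, §3 Lemma (3.6), proof (p0007 L22–L28)] [cite: Gordon1997, §2.16 Proposition] -/
theorem finite_hodgeGroupCProdInr_iff_nonempty_lieEquiv_hodgeGroupLieRat :
    ((hodgeGroupCProdInr Φ₁ Φ₂ : Subgroup (SpecialLinearGroup ι₂ ℂ)) : Set (SpecialLinearGroup ι₂ ℂ)).Finite ↔
      Nonempty (hodgeGroupLieRat (prodPeriod Φ₁ Φ₂) ≃ₗ⁅ℚ⁆ hodgeGroupLieRat Φ₁) := by
  constructor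
  · intro h
    rw [finite_hodgeGroupCProdInr_iff_forall_zero_fromBlocks_mem_imp] at h
    obtain ⟨f, g, hf, -, hfs, -, -⟩ := exists_lieHom_toBlocks_rat Φ₁ Φ₂
    refine ⟨LieEquiv.ofBijective f ⟨fun C D hCD ↦ Subtype.ext ?_, hfs⟩⟩
    have h₁ : (C : Matrix (ι₁ ⊕ ι₂) (ι₁ ⊕ ι₂) ℚ).toBlocks₁₁ = (D : Matrix (ι₁ ⊕ ι₂) (ι₁ ⊕ ι₂) ℚ).toBlocks₁₁ := by
      rw [← hf C, ← hf D, hCD]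
    have hsub := sub_mem C.2 D.2
    have heq : (C : Matrix (ι₁ ⊕ ι₂) (ι₁ ⊕ ι₂) ℚ) - (D : Matrix (ι₁ ⊕ ι₂) (ι₁ ⊕ ι₂) ℚ) =
        fromBlocks 0 0 0 ((C : Matrix (ι₁ ⊕ ι₂) (ι₁ ⊕ ι₂) ℚ).toBlocks₂₂ - (D : Matrix (ι₁ ⊕ ι₂) (ι₁ ⊕ ι₂) ℚ).toBlocks₂₂) := by
      conv_lhs => rw [eq_fromBlocks_of_mem_hodgeGroupLieRat_prod Φ₁ Φ₂ C.2, eq_fromBlocks_of_mem_hodgeGroupLieRat_prod Φ₁ Φ₂ D.2, h₁]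
      simp only [sub_eq_add_neg, fromBlocks_neg, fromBlocks_add, neg_zero, add_zero, add_neg_cancel]
    rw [heq] at hsub
    have h₂ := sub_eq_zero.1 (h _ hsub)
    rw [eq_fromBlocks_of_mem_hodgeGroupLieRat_prod Φ₁ Φ₂ C.2, eq_fromBlocks_of_mem_hodgeGroupLieRat_prod Φ₁ Φ₂ D.2, h₁, h₂]
  · rintro ⟨e⟩
    rw [finite_hodgeGroupCProdInr_iff_finrank_hodgeGroupLieRat_prod_eq]
    exact e.toLinearEquiv.finrank_eq

/-- **`K₁` FINITE ⟺ `r₂ : 𝒜(X₁ × X₂) ≅ 𝒜(X₂)` OVER `ℚ`.** [cite: MoonenZarhin1999LowDim, §3 Lemma (3.6), proof] [cite: Gordon1997, §2.16 Proposition] -/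
theorem finite_hodgeGroupCProdInl_iff_nonempty_lieEquiv_hodgeGroupLieRat :
    ((hodgeGroupCProdInl Φ₁ Φ₂ : Subgroup (SpecialLinearGroup ι₁ ℂ)) : Set (SpecialLinearGroup ι₁ ℂ)).Finite ↔
      Nonempty (hodgeGroupLieRat (prodPeriod Φ₁ Φ₂) ≃ₗ⁅ℚ⁆ hodgeGroupLieRat Φ₂) := by
  constructor
  · intro h
    rw [finite_hodgeGroupCProdInl_iff_forall_fromBlocks_zero_mem_imp] at h
    obtain ⟨f, g, -, hg, -, hgs, -⟩ := exists_lieHom_toBlocks_rat Φ₁ Φ₂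
    refine ⟨LieEquiv.ofBijective g ⟨fun C D hCD ↦ Subtype.ext ?_, hgs⟩⟩
    have h₂ : (C : Matrix (ι₁ ⊕ ι₂) (ι₁ ⊕ ι₂) ℚ).toBlocks₂₂ = (D : Matrix (ι₁ ⊕ ι₂) (ι₁ ⊕ ι₂) ℚ).toBlocks₂₂ := by
      rw [← hg C, ← hg D, hCD]
    have hsub := sub_mem C.2 D.2
    have heq : (C : Matrix (ι₁ ⊕ ι₂) (ι₁ ⊕ ι₂) ℚ) - (D : Matrix (ι₁ ⊕ ι₂) (ι₁ ⊕ ι₂) ℚ) =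
        fromBlocks ((C : Matrix (ι₁ ⊕ ι₂) (ι₁ ⊕ ι₂) ℚ).toBlocks₁₁ - (D : Matrix (ι₁ ⊕ ι₂) (ι₁ ⊕ ι₂) ℚ).toBlocks₁₁) 0 0 0 := by
      conv_lhs => rw [eq_fromBlocks_of_mem_hodgeGroupLieRat_prod Φ₁ Φ₂ C.2, eq_fromBlocks_of_mem_hodgeGroupLieRat_prod Φ₁ Φ₂ D.2, h₂]
      simp only [sub_eq_add_neg, fromBlocks_neg, fromBlocks_add, neg_zero, add_zero, add_neg_cancel]
    rw [heq] at hsub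
    have h₁ := sub_eq_zero.1 (h _ hsub)
    rw [eq_fromBlocks_of_mem_hodgeGroupLieRat_prod Φ₁ Φ₂ C.2, eq_fromBlocks_of_mem_hodgeGroupLieRat_prod Φ₁ Φ₂ D.2, h₁, h₂]
  · rintro ⟨e⟩
    rw [finite_hodgeGroupCProdInl_iff_finrank_hodgeGroupLieRat_prod_eq]
    exact e.toLinearEquiv.finrank_eq

/-- A quotient factor (`P ∈ Hom_ℚ(X₁, X₂)` with `P Q = 1`) has finite `K₂`. [cite: MoonenZarhin1999LowDim, §1 and §3 (3.1)] [cite: Imai1976HodgeGroups, §3 Remarks] -/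
theorem finite_hodgeGroupCProdInr_of_mem_homRat_of_right_inverse {P : Matrix ι₂ ι₁ ℚ} (hP : P ∈ homRat Φ₁ Φ₂)
    {Q : Matrix ι₁ ι₂ ℚ} (hPQ : P * Q = 1) :
    ((hodgeGroupCProdInr Φ₁ Φ₂ : Subgroup (SpecialLinearGroup ι₂ ℂ)) : Set (SpecialLinearGroup ι₂ ℂ)).Finite :=
  (finite_hodgeGroupCProdInr_iff_forall_zero_fromBlocks_mem_imp Φ₁ Φ₂).2
    fun _ hW ↦ eq_zero_of_zero_fromBlocks_mem_of_right_inverse Φ₁ Φ₂ hP hPQ hW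

/-- An embedded factor (`P ∈ Hom_ℚ(X₁, X₂)` with `Q P = 1`) has finite `K₁`. [cite: MoonenZarhin1999LowDim, §1 and §3 (3.1)] [cite: Imai1976HodgeGroups, §3 Remarks] -/
theorem finite_hodgeGroupCProdInl_of_mem_homRat_of_left_inverse {P : Matrix ι₂ ι₁ ℚ} (hP : P ∈ homRat Φ₁ Φ₂)
    {Q : Matrix ι₁ ι₂ ℚ} (hQP : Q * P = 1) :
    ((hodgeGroupCProdInl Φ₁ Φ₂ : Subgroup (SpecialLinearGroup ι₁ ℂ)) : Set (SpecialLinearGroup ι₁ ℂ)).Finite :=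
  (finite_hodgeGroupCProdInl_iff_forall_fromBlocks_zero_mem_imp Φ₁ Φ₂).2
    fun _ hW ↦ eq_zero_of_fromBlocks_zero_mem_of_left_inverse Φ₁ Φ₂ hP hQP hW

variable {Φ₁ Φ₂} in
/-- **ISOGENOUS FACTORS: both kernels `K₁`, `K₂` are finite** (`Hg(X₁ × X₂) → Hg(Xᵢ)` are isogenies; the graph).
[cite: Imai1976HodgeGroups, §3 Remarks] [cite: MoonenZarhin1999LowDim, (0.2)(4) and §1] -/
theorem IsIsogenous.finite_hodgeGroupCProdInl_and_Inr (hiso : IsIsogenous Φ₁ Φ₂) :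
    ((hodgeGroupCProdInl Φ₁ Φ₂ : Subgroup (SpecialLinearGroup ι₁ ℂ)) : Set (SpecialLinearGroup ι₁ ℂ)).Finite ∧
      ((hodgeGroupCProdInr Φ₁ Φ₂ : Subgroup (SpecialLinearGroup ι₂ ℂ)) : Set (SpecialLinearGroup ι₂ ℂ)).Finite := by
  obtain ⟨A, hA⟩ := hiso
  obtain ⟨Q, -, hQA, hAQ⟩ := hA.exists_homRat_inverse
  exact ⟨finite_hodgeGroupCProdInl_of_mem_homRat_of_left_inverse Φ₁ Φ₂ hA.map_intCast_mem_homRat hQA,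
    finite_hodgeGroupCProdInr_of_mem_homRat_of_right_inverse Φ₁ Φ₂ hA.map_intCast_mem_homRat hAQ⟩

/-! ### §3 Transfer along a finite kernel, over `ℚ`: `K₁` finite ⟹ `𝒜(X₁)` is a quotient of `𝒜(X₂)` -/

/-- **`K₁` FINITE ⟹ A SURJECTIVE HOMOMORPHISM `𝒜(X₂) ↠ 𝒜(X₁)` OF `ℚ`-LIE ALGEBRAS** (`r₁ ∘ r₂⁻¹`: «`𝔥𝔤(X₁) ≅ 𝔥𝔤(X₁ × X₂) ⧸ 𝔤₂`» with
`𝔥𝔤(X₁ × X₂) ≅ 𝔥𝔤(X₂)`). [cite: MoonenZarhin1999LowDim, §3 (3.1) and Lemma (3.6), proof] [cite: Gordon1997, §2.16 Proposition] -/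
theorem exists_surjective_lieHom_hodgeGroupLieRat_of_finite_hodgeGroupCProdInl
    (h : ((hodgeGroupCProdInl Φ₁ Φ₂ : Subgroup (SpecialLinearGroup ι₁ ℂ)) : Set (SpecialLinearGroup ι₁ ℂ)).Finite) :
    ∃ φ : hodgeGroupLieRat Φ₂ →ₗ⁅ℚ⁆ hodgeGroupLieRat Φ₁, Surjective φ := by
  obtain ⟨e⟩ := (finite_hodgeGroupCProdInl_iff_nonempty_lieEquiv_hodgeGroupLieRat Φ₁ Φ₂).1 h
  obtain ⟨f, g, -, -, hfs, -, -⟩ := exists_lieHom_toBlocks_rat Φ₁ Φ₂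
  -- `r₁` (onto) composed with the inverse of the `ℚ`-isomorphism `r₂ : 𝒜(X₁ × X₂) ≅ 𝒜(X₂)`
  exact ⟨f.comp e.symm.toLieHom, hfs.comp e.symm.surjective⟩

/-- **`K₂` FINITE ⟹ `𝒜(X₁) ↠ 𝒜(X₂)` over `ℚ`** (`r₂ ∘ r₁⁻¹`). [cite: MoonenZarhin1999LowDim, §3 (3.1) and Lemma (3.6), proof] [cite: Gordon1997, §2.16 Proposition] -/
theorem exists_surjective_lieHom_hodgeGroupLieRat_of_finite_hodgeGroupCProdInr
    (h : ((hodgeGroupCProdInr Φ₁ Φ₂ : Subgroup (SpecialLinearGroup ι₂ ℂ)) : Set (SpecialLinearGroup ι₂ ℂ)).Finite) :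
    ∃ φ : hodgeGroupLieRat Φ₁ →ₗ⁅ℚ⁆ hodgeGroupLieRat Φ₂, Surjective φ := by
  obtain ⟨e⟩ := (finite_hodgeGroupCProdInr_iff_nonempty_lieEquiv_hodgeGroupLieRat Φ₁ Φ₂).1 h
  obtain ⟨f, g, -, -, -, hgs, -⟩ := exists_lieHom_toBlocks_rat Φ₁ Φ₂
  -- `r₂` (onto) composed with the inverse of the `ℚ`-isomorphism `r₁ : 𝒜(X₁ × X₂) ≅ 𝒜(X₁)`
  exact ⟨g.comp e.symm.toLieHom, hgs.comp e.symm.surjective⟩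

/-- `K₁` finite, `𝒜(X₂)` abelian ⟹ `𝒜(X₁)` abelian. [cite: MoonenZarhin1999LowDim, §3 Lemma (3.6)] [cite: Bourbaki1989LieGroups13, Ch. I §1] -/
theorem isLieAbelian_hodgeGroupLieRat_of_finite_hodgeGroupCProdInl [IsLieAbelian (hodgeGroupLieRat Φ₂)]
    (h : ((hodgeGroupCProdInl Φ₁ Φ₂ : Subgroup (SpecialLinearGroup ι₁ ℂ)) : Set (SpecialLinearGroup ι₁ ℂ)).Finite) :
    IsLieAbelian (hodgeGroupLieRat Φ₁) := by
  obtain ⟨φ, hφ⟩ := exists_surjective_lieHom_hodgeGroupLieRat_of_finite_hodgeGroupCProdInl Φ₁ Φ₂ h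
  exact hφ.isLieAbelian inferInstance

/-- `K₁` finite, `𝒜(X₂)` solvable ⟹ `𝒜(X₁)` solvable. [cite: MoonenZarhin1999LowDim, §3 Lemma (3.6)] [cite: Bourbaki1989LieGroups13, Ch. I §5] -/
theorem isSolvable_hodgeGroupLieRat_of_finite_hodgeGroupCProdInl [LieAlgebra.IsSolvable (hodgeGroupLieRat Φ₂)]
    (h : ((hodgeGroupCProdInl Φ₁ Φ₂ : Subgroup (SpecialLinearGroup ι₁ ℂ)) : Set (SpecialLinearGroup ι₁ ℂ)).Finite) :
    LieAlgebra.IsSolvable (hodgeGroupLieRat Φ₁) := by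
  obtain ⟨φ, hφ⟩ := exists_surjective_lieHom_hodgeGroupLieRat_of_finite_hodgeGroupCProdInl Φ₁ Φ₂ h
  exact hφ.lieAlgebra_isSolvable

/-- `K₁` finite, `𝒜(X₂)` semisimple over `ℚ` ⟹ `𝒜(X₁)` semisimple over `ℚ`. [cite: Bourbaki1989LieGroups13, Ch. I §6 no. 2 Lemma 1]
[cite: MoonenZarhin1999LowDim, §3 (3.1)] -/
theorem isSemisimple_hodgeGroupLieRat_of_finite_hodgeGroupCProdInl [LieAlgebra.IsSemisimple ℚ (hodgeGroupLieRat Φ₂)]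
    (h : ((hodgeGroupCProdInl Φ₁ Φ₂ : Subgroup (SpecialLinearGroup ι₁ ℂ)) : Set (SpecialLinearGroup ι₁ ℂ)).Finite) :
    LieAlgebra.IsSemisimple ℚ (hodgeGroupLieRat Φ₁) := by
  haveI := finite_hodgeGroupLieRat Φ₁
  haveI := finite_hodgeGroupLieRat Φ₂
  obtain ⟨φ, hφ⟩ := exists_surjective_lieHom_hodgeGroupLieRat_of_finite_hodgeGroupCProdInl Φ₁ Φ₂ h
  exact isSemisimple_of_surjective φ hφ

/-- `K₁` finite, `𝒜(X₂)` reductive over `ℚ` (e.g. `X₂` polarised) ⟹ `𝒜(X₁)` reductive over `ℚ`. [cite: Bourbaki1989LieGroups13, Ch. I §6 no. 4 Cor. (c)]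
[cite: MoonenZarhin1999LowDim, §3 (3.1)] -/
theorem hasCentralRadical_hodgeGroupLieRat_of_finite_hodgeGroupCProdInl [LieAlgebra.HasCentralRadical ℚ (hodgeGroupLieRat Φ₂)]
    (h : ((hodgeGroupCProdInl Φ₁ Φ₂ : Subgroup (SpecialLinearGroup ι₁ ℂ)) : Set (SpecialLinearGroup ι₁ ℂ)).Finite) :
    LieAlgebra.HasCentralRadical ℚ (hodgeGroupLieRat Φ₁) := by
  haveI := finite_hodgeGroupLieRat Φ₁
  haveI := finite_hodgeGroupLieRat Φ₂
  obtain ⟨φ, hφ⟩ := exists_surjective_lieHom_hodgeGroupLieRat_of_finite_hodgeGroupCProdInl Φ₁ Φ₂ h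
  exact hasCentralRadical_of_surjective φ hφ

/-- `K₂` finite, `𝒜(X₁)` abelian ⟹ `𝒜(X₂)` abelian. [cite: MoonenZarhin1999LowDim, §3 Lemma (3.6)] [cite: Bourbaki1989LieGroups13, Ch. I §1] -/
theorem isLieAbelian_hodgeGroupLieRat_of_finite_hodgeGroupCProdInr [IsLieAbelian (hodgeGroupLieRat Φ₁)]
    (h : ((hodgeGroupCProdInr Φ₁ Φ₂ : Subgroup (SpecialLinearGroup ι₂ ℂ)) : Set (SpecialLinearGroup ι₂ ℂ)).Finite) :
    IsLieAbelian (hodgeGroupLieRat Φ₂) := by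
  obtain ⟨φ, hφ⟩ := exists_surjective_lieHom_hodgeGroupLieRat_of_finite_hodgeGroupCProdInr Φ₁ Φ₂ h
  exact hφ.isLieAbelian inferInstance

/-- `K₂` finite, `𝒜(X₁)` solvable ⟹ `𝒜(X₂)` solvable. [cite: MoonenZarhin1999LowDim, §3 Lemma (3.6)] [cite: Bourbaki1989LieGroups13, Ch. I §5] -/
theorem isSolvable_hodgeGroupLieRat_of_finite_hodgeGroupCProdInr [LieAlgebra.IsSolvable (hodgeGroupLieRat Φ₁)]
    (h : ((hodgeGroupCProdInr Φ₁ Φ₂ : Subgroup (SpecialLinearGroup ι₂ ℂ)) : Set (SpecialLinearGroup ι₂ ℂ)).Finite) :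
    LieAlgebra.IsSolvable (hodgeGroupLieRat Φ₂) := by
  obtain ⟨φ, hφ⟩ := exists_surjective_lieHom_hodgeGroupLieRat_of_finite_hodgeGroupCProdInr Φ₁ Φ₂ h
  exact hφ.lieAlgebra_isSolvable

/-- `K₂` finite, `𝒜(X₁)` semisimple over `ℚ` ⟹ `𝒜(X₂)` semisimple over `ℚ`. [cite: Bourbaki1989LieGroups13, Ch. I §6 no. 2 Lemma 1]
[cite: MoonenZarhin1999LowDim, §3 (3.1)] -/
theorem isSemisimple_hodgeGroupLieRat_of_finite_hodgeGroupCProdInr [LieAlgebra.IsSemisimple ℚ (hodgeGroupLieRat Φ₁)]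
    (h : ((hodgeGroupCProdInr Φ₁ Φ₂ : Subgroup (SpecialLinearGroup ι₂ ℂ)) : Set (SpecialLinearGroup ι₂ ℂ)).Finite) :
    LieAlgebra.IsSemisimple ℚ (hodgeGroupLieRat Φ₂) := by
  haveI := finite_hodgeGroupLieRat Φ₁
  haveI := finite_hodgeGroupLieRat Φ₂
  obtain ⟨φ, hφ⟩ := exists_surjective_lieHom_hodgeGroupLieRat_of_finite_hodgeGroupCProdInr Φ₁ Φ₂ h
  exact isSemisimple_of_surjective φ hφ

/-- `K₂` finite, `𝒜(X₁)` reductive over `ℚ` ⟹ `𝒜(X₂)` reductive over `ℚ`. [cite: Bourbaki1989LieGroups13, Ch. I §6 no. 4 Cor. (c)]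
[cite: MoonenZarhin1999LowDim, §3 (3.1)] -/
theorem hasCentralRadical_hodgeGroupLieRat_of_finite_hodgeGroupCProdInr [LieAlgebra.HasCentralRadical ℚ (hodgeGroupLieRat Φ₁)]
    (h : ((hodgeGroupCProdInr Φ₁ Φ₂ : Subgroup (SpecialLinearGroup ι₂ ℂ)) : Set (SpecialLinearGroup ι₂ ℂ)).Finite) :
    LieAlgebra.HasCentralRadical ℚ (hodgeGroupLieRat Φ₂) := by
  haveI := finite_hodgeGroupLieRat Φ₁
  haveI := finite_hodgeGroupLieRat Φ₂
  obtain ⟨φ, hφ⟩ := exists_surjective_lieHom_hodgeGroupLieRat_of_finite_hodgeGroupCProdInr Φ₁ Φ₂ h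
  exact hasCentralRadical_of_surjective φ hφ

/-! ### §4 Dimension bookkeeping and a Hodge-simple factor dominating through a finite kernel -/

/-- `dim_ℚ 𝒜(X₁) ≤ dim_ℚ 𝒜(X₁ × X₂)` (`r₁` is onto; `dim_ℚ 𝒜(X₁ × X₂) = dim_ℚ 𝒜(X₁) + dim_ℚ 𝔤₂(ℚ)`).
[cite: MoonenZarhin1999LowDim, §3 (3.1)] [cite: GreenGriffithsKerr2012, §III.B (i)] -/
theorem finrank_hodgeGroupLieRat_left_le_prod :
    finrank ℚ (hodgeGroupLieRat Φ₁) ≤ finrank ℚ (hodgeGroupLieRat (prodPeriod Φ₁ Φ₂)) := by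
  obtain ⟨N₁, N₂, -, -, -, -, -, -, -, hdim, -⟩ := exists_lieIdeal_rat_lieEquiv_quotient Φ₁ Φ₂
  omega

/-- `dim_ℚ 𝒜(X₂) ≤ dim_ℚ 𝒜(X₁ × X₂)`. [cite: MoonenZarhin1999LowDim, §3 (3.1)] [cite: GreenGriffithsKerr2012, §III.B (i)] -/
theorem finrank_hodgeGroupLieRat_right_le_prod :
    finrank ℚ (hodgeGroupLieRat Φ₂) ≤ finrank ℚ (hodgeGroupLieRat (prodPeriod Φ₁ Φ₂)) := by
  obtain ⟨N₁, N₂, -, -, -, -, -, -, -, -, hdim⟩ := exists_lieIdeal_rat_lieEquiv_quotient Φ₁ Φ₂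
  omega

/-- `K₁` finite ⟹ `dim_ℚ 𝒜(X₁) ≤ dim_ℚ 𝒜(X₂)` (`𝒜(X₁)` is a quotient of `𝒜(X₂)`). [cite: MoonenZarhin1999LowDim, §3 (3.1) and Lemma (3.6), proof] -/
theorem finrank_hodgeGroupLieRat_le_of_finite_hodgeGroupCProdInl
    (h : ((hodgeGroupCProdInl Φ₁ Φ₂ : Subgroup (SpecialLinearGroup ι₁ ℂ)) : Set (SpecialLinearGroup ι₁ ℂ)).Finite) :
    finrank ℚ (hodgeGroupLieRat Φ₁) ≤ finrank ℚ (hodgeGroupLieRat Φ₂) := by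
  rw [← (finite_hodgeGroupCProdInl_iff_finrank_hodgeGroupLieRat_prod_eq Φ₁ Φ₂).1 h]
  exact finrank_hodgeGroupLieRat_left_le_prod Φ₁ Φ₂

/-- `K₂` finite ⟹ `dim_ℚ 𝒜(X₂) ≤ dim_ℚ 𝒜(X₁)`. [cite: MoonenZarhin1999LowDim, §3 (3.1) and Lemma (3.6), proof] -/
theorem finrank_hodgeGroupLieRat_le_of_finite_hodgeGroupCProdInr
    (h : ((hodgeGroupCProdInr Φ₁ Φ₂ : Subgroup (SpecialLinearGroup ι₂ ℂ)) : Set (SpecialLinearGroup ι₂ ℂ)).Finite) :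
    finrank ℚ (hodgeGroupLieRat Φ₂) ≤ finrank ℚ (hodgeGroupLieRat Φ₁) := by
  rw [← (finite_hodgeGroupCProdInr_iff_finrank_hodgeGroupLieRat_prod_eq Φ₁ Φ₂).1 h]
  exact finrank_hodgeGroupLieRat_right_le_prod Φ₁ Φ₂

/-- `K₁` finite and `dim_ℚ 𝒜(X₂) ≤ dim_ℚ 𝒜(X₁)` ⟹ `K₂` finite (then `dim_ℚ 𝒜(X₁) = dim_ℚ 𝒜(X₁ × X₂) = dim_ℚ 𝒜(X₂)`).
[cite: MoonenZarhin1999LowDim, §3 (3.1)] [cite: Springer1998, 2.2.1 and 1.8.2] -/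
theorem finite_hodgeGroupCProdInr_of_finite_hodgeGroupCProdInl_of_finrank_le
    (h : ((hodgeGroupCProdInl Φ₁ Φ₂ : Subgroup (SpecialLinearGroup ι₁ ℂ)) : Set (SpecialLinearGroup ι₁ ℂ)).Finite)
    (hle : finrank ℚ (hodgeGroupLieRat Φ₂) ≤ finrank ℚ (hodgeGroupLieRat Φ₁)) :
    ((hodgeGroupCProdInr Φ₁ Φ₂ : Subgroup (SpecialLinearGroup ι₂ ℂ)) : Set (SpecialLinearGroup ι₂ ℂ)).Finite := by
  rw [finite_hodgeGroupCProdInl_iff_finrank_hodgeGroupLieRat_prod_eq] at h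
  rw [finite_hodgeGroupCProdInr_iff_finrank_hodgeGroupLieRat_prod_eq]
  exact le_antisymm (h ▸ hle) (finrank_hodgeGroupLieRat_left_le_prod Φ₁ Φ₂)

/-- `K₂` finite and `dim_ℚ 𝒜(X₁) ≤ dim_ℚ 𝒜(X₂)` ⟹ `K₁` finite. [cite: MoonenZarhin1999LowDim, §3 (3.1)] [cite: Springer1998, 2.2.1 and 1.8.2] -/
theorem finite_hodgeGroupCProdInl_of_finite_hodgeGroupCProdInr_of_finrank_le
    (h : ((hodgeGroupCProdInr Φ₁ Φ₂ : Subgroup (SpecialLinearGroup ι₂ ℂ)) : Set (SpecialLinearGroup ι₂ ℂ)).Finite)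
    (hle : finrank ℚ (hodgeGroupLieRat Φ₁) ≤ finrank ℚ (hodgeGroupLieRat Φ₂)) :
    ((hodgeGroupCProdInl Φ₁ Φ₂ : Subgroup (SpecialLinearGroup ι₁ ℂ)) : Set (SpecialLinearGroup ι₁ ℂ)).Finite := by
  rw [finite_hodgeGroupCProdInr_iff_finrank_hodgeGroupLieRat_prod_eq] at h
  rw [finite_hodgeGroupCProdInl_iff_finrank_hodgeGroupLieRat_prod_eq]
  exact le_antisymm (h ▸ hle) (finrank_hodgeGroupLieRat_right_le_prod Φ₁ Φ₂)

/-- When `dim_ℚ 𝒜(X₁) = dim_ℚ 𝒜(X₂)`: `K₁` finite ⟺ `K₂` finite. [cite: MoonenZarhin1999LowDim, §3 (3.1)] [cite: Springer1998, 2.2.1 and 1.8.2] -/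
theorem finite_hodgeGroupCProdInl_iff_finite_hodgeGroupCProdInr_of_finrank_eq
    (heq : finrank ℚ (hodgeGroupLieRat Φ₁) = finrank ℚ (hodgeGroupLieRat Φ₂)) :
    ((hodgeGroupCProdInl Φ₁ Φ₂ : Subgroup (SpecialLinearGroup ι₁ ℂ)) : Set (SpecialLinearGroup ι₁ ℂ)).Finite ↔
      ((hodgeGroupCProdInr Φ₁ Φ₂ : Subgroup (SpecialLinearGroup ι₂ ℂ)) : Set (SpecialLinearGroup ι₂ ℂ)).Finite :=
  ⟨fun h ↦ finite_hodgeGroupCProdInr_of_finite_hodgeGroupCProdInl_of_finrank_le Φ₁ Φ₂ h heq.ge,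
    fun h ↦ finite_hodgeGroupCProdInl_of_finite_hodgeGroupCProdInr_of_finrank_le Φ₁ Φ₂ h heq.le⟩

/-- **A HODGE-SIMPLE FACTOR DOMINATING THROUGH A FINITE KERNEL**: `𝒜(X₂)` simple over `ℚ`, `K₁` finite, `dim X₁ > 0` ⟹
`𝒜(X₁) ≅ 𝒜(X₂)` over `ℚ` (the surjection `𝒜(X₂) ↠ 𝒜(X₁)` of §3 has kernel an ideal of a simple algebra, and `𝒜(X₁) ∋ J`-part is
non-zero). [cite: MoonenZarhin1999LowDim, §3 Lemma (3.6), proof] [cite: Bourbaki1989LieGroups13, Ch. I §6 no. 2] [cite: Gordon1997, §2.16 Proposition] -/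
theorem nonempty_hodgeGroupLieRat_lieEquiv_of_isSimple_right_of_finite_hodgeGroupCProdInl [Nonempty ι₁]
    [LieAlgebra.IsSimple ℚ (hodgeGroupLieRat Φ₂)]
    (h : ((hodgeGroupCProdInl Φ₁ Φ₂ : Subgroup (SpecialLinearGroup ι₁ ℂ)) : Set (SpecialLinearGroup ι₁ ℂ)).Finite) :
    Nonempty (hodgeGroupLieRat Φ₁ ≃ₗ⁅ℚ⁆ hodgeGroupLieRat Φ₂) := by
  obtain ⟨φ, hφ⟩ := exists_surjective_lieHom_hodgeGroupLieRat_of_finite_hodgeGroupCProdInl Φ₁ Φ₂ h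
  have hker : φ.ker = ⊥ := by
    rcases LieAlgebra.IsSimple.eq_bot_or_eq_top φ.ker with hbot | htop
    · exact hbot
    · exfalso
      have hzero : ∀ x : hodgeGroupLieRat Φ₁, x = 0 := fun x ↦ by
        obtain ⟨y, rfl⟩ := hφ x
        have hy : y ∈ φ.ker := by rw [htop]; exact LieSubmodule.mem_top y
        exact LieHom.mem_ker.1 hy
      haveI : Subsingleton (hodgeGroupLieRat Φ₁) := ⟨fun a b ↦ by rw [hzero a, hzero b]⟩
      exact absurd Module.finrank_zero_of_subsingleton (finrank_hodgeGroupLieRat_pos Φ₁).ne'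
  exact ⟨(LieEquiv.ofBijective φ ⟨φ.ker_eq_bot.1 hker, hφ⟩).symm⟩

/-- … and then `K₂` is finite as well (`dim_ℚ 𝒜(X₁) = dim_ℚ 𝒜(X₂)`): both projections `Hg(X₁ × X₂) → Hg(Xᵢ)` are isogenies.
[cite: MoonenZarhin1999LowDim, §3 Lemma (3.6), proof] [cite: Gordon1997, §2.16 Proposition] -/
theorem finite_hodgeGroupCProdInr_of_isSimple_right_of_finite_hodgeGroupCProdInl [Nonempty ι₁]
    [LieAlgebra.IsSimple ℚ (hodgeGroupLieRat Φ₂)]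
    (h : ((hodgeGroupCProdInl Φ₁ Φ₂ : Subgroup (SpecialLinearGroup ι₁ ℂ)) : Set (SpecialLinearGroup ι₁ ℂ)).Finite) :
    ((hodgeGroupCProdInr Φ₁ Φ₂ : Subgroup (SpecialLinearGroup ι₂ ℂ)) : Set (SpecialLinearGroup ι₂ ℂ)).Finite := by
  obtain ⟨e⟩ := nonempty_hodgeGroupLieRat_lieEquiv_of_isSimple_right_of_finite_hodgeGroupCProdInl Φ₁ Φ₂ h
  exact finite_hodgeGroupCProdInr_of_finite_hodgeGroupCProdInl_of_finrank_le Φ₁ Φ₂ h e.toLinearEquiv.finrank_eq.ge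

/-- Mirror: `𝒜(X₁)` simple over `ℚ`, `K₂` finite, `dim X₂ > 0` ⟹ `𝒜(X₁) ≅ 𝒜(X₂)` over `ℚ`.
[cite: MoonenZarhin1999LowDim, §3 Lemma (3.6), proof] [cite: Bourbaki1989LieGroups13, Ch. I §6 no. 2] [cite: Gordon1997, §2.16 Proposition] -/
theorem nonempty_hodgeGroupLieRat_lieEquiv_of_isSimple_left_of_finite_hodgeGroupCProdInr [Nonempty ι₂]
    [LieAlgebra.IsSimple ℚ (hodgeGroupLieRat Φ₁)]
    (h : ((hodgeGroupCProdInr Φ₁ Φ₂ : Subgroup (SpecialLinearGroup ι₂ ℂ)) : Set (SpecialLinearGroup ι₂ ℂ)).Finite) :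
    Nonempty (hodgeGroupLieRat Φ₁ ≃ₗ⁅ℚ⁆ hodgeGroupLieRat Φ₂) := by
  obtain ⟨φ, hφ⟩ := exists_surjective_lieHom_hodgeGroupLieRat_of_finite_hodgeGroupCProdInr Φ₁ Φ₂ h
  have hker : φ.ker = ⊥ := by
    rcases LieAlgebra.IsSimple.eq_bot_or_eq_top φ.ker with hbot | htop
    · exact hbot
    · exfalso
      have hzero : ∀ x : hodgeGroupLieRat Φ₂, x = 0 := fun x ↦ by
        obtain ⟨y, rfl⟩ := hφ x
        have hy : y ∈ φ.ker := by rw [htop]; exact LieSubmodule.mem_top y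
        exact LieHom.mem_ker.1 hy
      haveI : Subsingleton (hodgeGroupLieRat Φ₂) := ⟨fun a b ↦ by rw [hzero a, hzero b]⟩
      exact absurd Module.finrank_zero_of_subsingleton (finrank_hodgeGroupLieRat_pos Φ₂).ne'
  exact ⟨LieEquiv.ofBijective φ ⟨φ.ker_eq_bot.1 hker, hφ⟩⟩

/-- … and then `K₁` is finite as well. [cite: MoonenZarhin1999LowDim, §3 Lemma (3.6), proof] [cite: Gordon1997, §2.16 Proposition] -/
theorem finite_hodgeGroupCProdInl_of_isSimple_left_of_finite_hodgeGroupCProdInr [Nonempty ι₂]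
    [LieAlgebra.IsSimple ℚ (hodgeGroupLieRat Φ₁)]
    (h : ((hodgeGroupCProdInr Φ₁ Φ₂ : Subgroup (SpecialLinearGroup ι₂ ℂ)) : Set (SpecialLinearGroup ι₂ ℂ)).Finite) :
    ((hodgeGroupCProdInl Φ₁ Φ₂ : Subgroup (SpecialLinearGroup ι₁ ℂ)) : Set (SpecialLinearGroup ι₁ ℂ)).Finite := by
  obtain ⟨e⟩ := nonempty_hodgeGroupLieRat_lieEquiv_of_isSimple_left_of_finite_hodgeGroupCProdInr Φ₁ Φ₂ h
  exact finite_hodgeGroupCProdInl_of_finite_hodgeGroupCProdInr_of_finrank_le Φ₁ Φ₂ h e.toLinearEquiv.finrank_eq.le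

end ComplexTorus

end Literature.Geometry.Kaehler
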